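import Summits.ValiantsHypothesis.ValiantsHypothesis.Theorems.BarrierLeverTransversalMinorLayoutsRelabel

/-!
# Route BarrierLever — conjecture TT (stmt-ValiantsHypothesis-19152): independent coordinate
# relabelings on rows and columns preserve the TT conclusion

Helper file (`--supports stmt-ValiantsHypothesis-19933`; cell valiant-natproofs, rung V4, 𝒟-side of
door (c); seat val-np-p1 gen 8).  `tt_layout_relabel`: if the TT layout matrix of `(u, w)` is
nonsingular for some `H`, then so is that of `(π • u, π' • w)` for any two coordinate permutations
`π, π'` acting on the row faces and on the column faces INDEPENDENTLY (`(u i).map π`,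
`(w j).map π'`).  Proof: the literal permutations `Lr, Lc` of `Fin (h + h)` induced by `π, π'`
satisfy `ρ(π • x) = Π ∘ ρ(x) ∘ π⁻¹`, `τ(π' • y) = Π' ∘ τ(y) ∘ π'⁻¹`; with `H' := H ∘ (Π⁻¹ × Π'⁻¹)`
every transversal minor of `(π • u, π' • w)` is the corresponding minor of `(u, w)` with rows and
columns permuted, i.e. the same up to the sign `sign π · sign π'`, so the layout determinant changes
by `(sign π · sign π')^r`.  (The priority-peeling analogue is `PPSmall.ppDerivable_layout_symm`; this
is the statement at the level of item 19152's conclusion, used to transport word certificates.)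

WHAT THIS IS NOT: a symmetry lemma; nothing on TT itself, on crux stmt-ValiantsHypothesis-14610, or
on `VP` versus `VNP`.
-/

-- layout Summits/ValiantsHypothesis/ValiantsHypothesis forces the duplicated namespace component
set_option linter.dupNamespace false

open Matrix Finset

namespace Summit.ValiantsHypothesis.ValiantsHypothesis.Theorems.BarrierLever.FiniteCheck

/-- The literal permutation of `Fin (h + h)` induced by a coordinate permutation. -/
theorem exists_literalPerm (h : ℕ) (π : Equiv.Perm (Fin h)) :
    ∃ Lr : Equiv.Perm (Fin (h + h)), (∀ a, Lr (Fin.castAdd h a) = Fin.castAdd h (π a)) ∧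
      ∀ a, Lr (Fin.natAdd h a) = Fin.natAdd h (π a) := by
  refine ⟨finSumFinEquiv.symm.trans ((Equiv.sumCongr π π).trans finSumFinEquiv), fun a => ?_,
    fun a => ?_⟩
  · simp only [Equiv.trans_apply, finSumFinEquiv_symm_apply_castAdd, Equiv.sumCongr_apply,
      Sum.map_inl, finSumFinEquiv_apply_left]
  · simp only [Equiv.trans_apply, finSumFinEquiv_symm_apply_natAdd, Equiv.sumCongr_apply,
      Sum.map_inr, finSumFinEquiv_apply_right]

/-- **Independent coordinate relabelings preserve the TT conclusion.** -/
theorem tt_layout_relabel (h r : ℕ) (u w : Fin r → Finset (Fin h)) (π π' : Equiv.Perm (Fin h))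
    (hgood : ∃ H : Matrix (Fin (h + h)) (Fin (h + h)) ℂ, (Matrix.of fun i j : Fin r => (H.submatrix
      (fun a : Fin h => if a ∈ u i then Fin.castAdd h a else Fin.natAdd h a)
      (fun c : Fin h => if c ∈ w j then Fin.natAdd h c else Fin.castAdd h c)).det).det ≠ 0) :
    ∃ H : Matrix (Fin (h + h)) (Fin (h + h)) ℂ, (Matrix.of fun i j : Fin r => (H.submatrix
      (fun a : Fin h => if a ∈ (u i).map π.toEmbedding then Fin.castAdd h a else Fin.natAdd h a)
      (fun c : Fin h => if c ∈ (w j).map π'.toEmbedding then Fin.natAdd h c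
        else Fin.castAdd h c)).det).det ≠ 0 := by
  classical
  obtain ⟨H, hH⟩ := hgood
  obtain ⟨Lr, hLr1, hLr2⟩ := exists_literalPerm h π
  obtain ⟨Lc, hLc1, hLc2⟩ := exists_literalPerm h π'
  set H' : Matrix (Fin (h + h)) (Fin (h + h)) ℂ := Matrix.of fun x y => H (Lr.symm x) (Lc.symm y)
    with hH'
  refine ⟨H', ?_⟩
  -- each new minor is the old minor with rows permuted by π⁻¹ and columns by π'⁻¹
  have hdet : ∀ i j : Fin r,
      (H'.submatrix
        (fun a : Fin h => if a ∈ (u i).map π.toEmbedding then Fin.castAdd h a else Fin.natAdd h a)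
        (fun c : Fin h => if c ∈ (w j).map π'.toEmbedding then Fin.natAdd h c
          else Fin.castAdd h c)).det =
      ((Equiv.Perm.sign π.symm : ℤ) : ℂ) * ((Equiv.Perm.sign π'.symm : ℤ) : ℂ) *
        (H.submatrix (fun a : Fin h => if a ∈ u i then Fin.castAdd h a else Fin.natAdd h a)
          (fun c : Fin h => if c ∈ w j then Fin.natAdd h c else Fin.castAdd h c)).det := by
    intro i j
    set M := H.submatrix (fun a : Fin h => if a ∈ u i then Fin.castAdd h a else Fin.natAdd h a)
      (fun c : Fin h => if c ∈ w j then Fin.natAdd h c else Fin.castAdd h c) with hM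
    have hmin : H'.submatrix
        (fun a : Fin h => if a ∈ (u i).map π.toEmbedding then Fin.castAdd h a else Fin.natAdd h a)
        (fun c : Fin h => if c ∈ (w j).map π'.toEmbedding then Fin.natAdd h c
          else Fin.castAdd h c) = (M.submatrix π.symm id).submatrix id π'.symm := by
      ext a c
      simp only [submatrix_apply, hH', Matrix.of_apply, hM, id]
      have ha : (if a ∈ (u i).map π.toEmbedding then Fin.castAdd h a else Fin.natAdd h a) =
          Lr (if π.symm a ∈ u i then Fin.castAdd h (π.symm a) else Fin.natAdd h (π.symm a)) := by
        by_cases hm : π.symm a ∈ u i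
        · rw [if_pos (Finset.mem_map_equiv.mpr hm), if_pos hm, hLr1, Equiv.apply_symm_apply]
        · rw [if_neg (fun h' => hm (Finset.mem_map_equiv.mp h')), if_neg hm, hLr2,
            Equiv.apply_symm_apply]
      have hc : (if c ∈ (w j).map π'.toEmbedding then Fin.natAdd h c else Fin.castAdd h c) =
          Lc (if π'.symm c ∈ w j then Fin.natAdd h (π'.symm c) else Fin.castAdd h (π'.symm c)) := by
        by_cases hm : π'.symm c ∈ w j
        · rw [if_pos (Finset.mem_map_equiv.mpr hm), if_pos hm, hLc2, Equiv.apply_symm_apply]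
        · rw [if_neg (fun h' => hm (Finset.mem_map_equiv.mp h')), if_neg hm, hLc1,
            Equiv.apply_symm_apply]
      rw [ha, hc, Equiv.symm_apply_apply, Equiv.symm_apply_apply]
    rw [hmin, Matrix.det_permute', Matrix.det_permute]
    ring
  have hL : (Matrix.of fun i j : Fin r => (H'.submatrix
        (fun a : Fin h => if a ∈ (u i).map π.toEmbedding then Fin.castAdd h a else Fin.natAdd h a)
        (fun c : Fin h => if c ∈ (w j).map π'.toEmbedding then Fin.natAdd h c
          else Fin.castAdd h c)).det) =
      (((Equiv.Perm.sign π.symm : ℤ) : ℂ) * ((Equiv.Perm.sign π'.symm : ℤ) : ℂ)) •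
      (Matrix.of fun i j : Fin r => (H.submatrix
        (fun a : Fin h => if a ∈ u i then Fin.castAdd h a else Fin.natAdd h a)
        (fun c : Fin h => if c ∈ w j then Fin.natAdd h c else Fin.castAdd h c)).det) := by
    ext i j
    rw [Matrix.of_apply, Matrix.smul_apply, Matrix.of_apply, smul_eq_mul]
    exact hdet i j
  rw [hL, Matrix.det_smul]
  refine mul_ne_zero (pow_ne_zero _ (mul_ne_zero ?_ ?_)) hH
  · exact_mod_cast (Equiv.Perm.sign π.symm).ne_zero
  · exact_mod_cast (Equiv.Perm.sign π'.symm).ne_zero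

end Summit.ValiantsHypothesis.ValiantsHypothesis.Theorems.BarrierLever.FiniteCheck
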